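/-
Origin: expansion seat `prover-pub-hodgecm-mc-binder-2-g10-0`, handover #24 23:11Z md5 9f29ad115f1f (145 l.; imports ONLY the twin `HodgeCM.Vendored.H21.NumberTheory.Weil1964.ThetaDualPairDatum` (RUN 35); §1 `WeilThetaDatum.continuousAdd_thetaTop` / `continuousConstSMul_thetaTop` (additive / homogeneous `Θ` ⇒ `ThetaTop` has continuous `+` / `•`), instances for `repWeilThetaDatum F ι ρ Γ`; §2 `slopeSubmodule`, `mem_slopeSubmodule_iff`, **`tendsto_slope_of_span`** (linear slopes `c a • (A a e − B e) → D e` extend from a spanning set to the whole module) — the tool by which the census field `smooth` passes from printed pure tensors to all printed vectors) (`HOME/mc/pub-hodgecm-mc-binder-2/g10/pkg/HodgeCM/Model/HypCensus/ThetaTopLinear.lean`, md5 9f29ad11, 145 lines);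
landed by the gen-13 packager (p-g13) in gate run 37 as `HodgeCM/Model/HypCensus/ThetaTopLinear.lean` (verbatim).
-/
/-
Origin: speedrun cell pub-hodgecm, MODEL-CONSTRUCTION sub-cell, lineage mc-binder-2 (BINDER-OWNERS rows 18/19: E binders
`hyp12` / `hyp34` of `Model.perL_picardCM_r15A`), seat prover-pub-hodgecm-mc-binder-2-g8-0 (gen 8), 2026-08-19.
Target in PKG: `HodgeCM/Model/HypCensus/ThetaTopLinear.lean` (NEW additive leaf; imports the twin
`Weil1964/ThetaDualPairDatum` (RUN 35) only).  KERNEL ONLY: 0 records, nothing cited, 0 `def … : Prop`; two instances and three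
lemmas of topological linear algebra.
-/
import Literature.NumberTheory.Weil1964.ThetaDualPairDatum

/-!
# Census kit (rows A12/A34): Weil's `Θ`-initial topology is a topological vector-space topology; slopes extend by linearity

The census field `HypSideW.smooth` (`HypCensus/SideW`) is a `Tendsto` statement for slopes `s⁻¹ • (ω(e_b s) Φ − Φ)` in Weil's
`Θ`-initial topology `ThetaTop` of the representation `ρ` (tree `Weil1964/ThetaInitialTopology`: the topology induced by
`Φ ↦ (g ↦ Θ(ρ(g)Φ)) ∈ (G →ᵤ[compacts] ℂ)`).  The kit proves it on PURE TENSORS of printed local vectors (`SmoothTheta`,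
`SmoothTwist`); the printed Fock space is SPANNED by them.  This leaf supplies the two missing generalities:

* §1 **`WeilThetaDatum.continuousAdd_thetaTop` / `continuousConstSMul_thetaTop`**: if `Φ ↦ Θ_Φ(S)` is additive / homogeneous,
  `ThetaTop` has continuous addition / scalar multiplication (an initial topology for additive maps into the topological group
  `Mp →ᵤ[compacts] ℂ`); instances for `repWeilThetaDatum F ι ρ Γ` (whose `Θ_Φ(g) = Θ(ρ(g)Φ)` is linear in `Φ`).
* §2 **`tendsto_slope_of_span`**: for linear `A s, B, D : E →ₗ X` into such a space, the vectors `e` with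
  `s⁻¹ • (A s e − B e) → D e` form a submodule; so the limit holds on `E` as soon as it holds on a spanning set.

Nothing here is a claim of PerL/QW8.  [Weil1964, Chap. III n° 41; Bourbaki TVS III §1] is the provenance of the notions.
-/

set_option autoImplicit false

noncomputable section

open Filter Topology
open scoped UniformConvergence

namespace Literature.NumberTheory.Weil1964.WeilThetaDatum

variable {Mp : Type*} {SX : Type*} [TopologicalSpace Mp]

/-- **Additive `Θ` ⇒ continuous addition on `ThetaTop`.** -/
theorem continuousAdd_thetaTop (D : WeilThetaDatum Mp SX) [AddCommGroup SX]
    (hadd : ∀ (Φ Ψ : SX) (S : Mp), D.theta (Φ + Ψ) S = D.theta Φ S + D.theta Ψ S) : ContinuousAdd D.ThetaTop := by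
  refine ⟨?_⟩
  rw [continuous_rng_iff]
  have hT := D.continuous_theta_uniformOnFun
  have h : (fun p : D.ThetaTop × D.ThetaTop => UniformOnFun.ofFun {K : Set Mp | IsCompact K} (D.theta (p.1 + p.2))) =
      fun p => UniformOnFun.ofFun {K : Set Mp | IsCompact K} (D.theta p.1) +
        UniformOnFun.ofFun {K : Set Mp | IsCompact K} (D.theta p.2) := by
    funext p
    have : D.theta (p.1 + p.2) = D.theta p.1 + D.theta p.2 := funext fun S => hadd p.1 p.2 S
    rw [this]
    rfl
  rw [h]
  exact (hT.comp continuous_fst).add (hT.comp continuous_snd)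

/-- **Homogeneous `Θ` ⇒ continuous scalar multiplication by constants on `ThetaTop`.** -/
theorem continuousConstSMul_thetaTop (D : WeilThetaDatum Mp SX) [AddCommGroup SX] [Module ℂ SX]
    (hsmul : ∀ (a : ℂ) (Φ : SX) (S : Mp), D.theta (a • Φ) S = a * D.theta Φ S) : ContinuousConstSMul ℂ D.ThetaTop := by
  refine ⟨fun a => ?_⟩
  rw [continuous_rng_iff]
  have hT := D.continuous_theta_uniformOnFun
  have h : (fun Φ : D.ThetaTop => UniformOnFun.ofFun {K : Set Mp | IsCompact K} (D.theta (a • Φ))) =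
      fun Φ => a • UniformOnFun.ofFun {K : Set Mp | IsCompact K} (D.theta Φ) := by
    funext Φ
    have : D.theta (a • Φ) = a • D.theta Φ := funext fun S => by rw [Pi.smul_apply, smul_eq_mul]; exact hsmul a Φ S
    rw [this]
    rfl
  rw [h]
  exact hT.const_smul a

end Literature.NumberTheory.Weil1964.WeilThetaDatum

namespace HodgeCM.Model.HypCensus

open Literature.NumberTheory.Weil1964 Literature.NumberTheory.Automorphic

section Rep

variable {F : Type} [Field F] [NumberField F] {ι : Type} [Fintype ι] {G : Type*} [Group G] [TopologicalSpace G]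
  (ρ : G →* (Module.End ℂ ↥(piSchwartzBruhat F ι))ˣ) (Γ : Set G)

/-- **Weil's `Θ`-initial topology of a linearised representation has continuous addition** (`Θ(ρ(g)·)` is additive). -/
instance continuousAdd_thetaTop_repWeilThetaDatum : ContinuousAdd (repWeilThetaDatum F ι ρ Γ).ThetaTop :=
  (repWeilThetaDatum F ι ρ Γ).continuousAdd_thetaTop fun Φ Ψ g => by
    change thetaDistLM F ι ((ρ g : Module.End ℂ ↥(piSchwartzBruhat F ι)) (Φ + Ψ)) =
      thetaDistLM F ι ((ρ g : Module.End ℂ ↥(piSchwartzBruhat F ι)) Φ) +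
        thetaDistLM F ι ((ρ g : Module.End ℂ ↥(piSchwartzBruhat F ι)) Ψ)
    rw [map_add, map_add]

/-- **… and continuous scalar multiplication by constants** (`Θ(ρ(g)·)` is `ℂ`-homogeneous). -/
instance continuousConstSMul_thetaTop_repWeilThetaDatum : ContinuousConstSMul ℂ (repWeilThetaDatum F ι ρ Γ).ThetaTop :=
  (repWeilThetaDatum F ι ρ Γ).continuousConstSMul_thetaTop fun a Φ g => by
    change thetaDistLM F ι ((ρ g : Module.End ℂ ↥(piSchwartzBruhat F ι)) (a • Φ)) =
      a * thetaDistLM F ι ((ρ g : Module.End ℂ ↥(piSchwartzBruhat F ι)) Φ)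
    rw [map_smul, map_smul, smul_eq_mul]

end Rep

/-! ## §2 Slopes extend by linearity -/

section Span

variable {E : Type*} [AddCommGroup E] [Module ℂ E] {X : Type*} [AddCommGroup X] [Module ℂ X] [TopologicalSpace X]
  [ContinuousAdd X] [ContinuousConstSMul ℂ X] {α : Type*} (l : Filter α) (c : α → ℂ)

/-- **The vectors with a given linear slope limit form a submodule**: for linear `A a`, `B`, `D`, the set of `e` with
`c a • (A a e − B e) → D e` along `l` is closed under `0`, `+`, `•`. -/
def slopeSubmodule (A : α → E →ₗ[ℂ] X) (B D : E →ₗ[ℂ] X) : Submodule ℂ E where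
  carrier := {e | Tendsto (fun a => c a • (A a e - B e)) l (𝓝 (D e))}
  zero_mem' := by
    change Tendsto (fun a => c a • (A a 0 - B 0)) l (𝓝 (D 0))
    simp only [map_zero, sub_zero, smul_zero]
    exact tendsto_const_nhds
  add_mem' {x y} hx hy := by
    change Tendsto (fun a => c a • (A a (x + y) - B (x + y))) l (𝓝 (D (x + y)))
    have h : (fun a => c a • (A a (x + y) - B (x + y))) = fun a => c a • (A a x - B x) + c a • (A a y - B y) := by
      funext a
      rw [map_add, map_add, ← smul_add]
      congr 1
      abel
    rw [h, map_add]
    exact hx.add hy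
  smul_mem' r x hx := by
    change Tendsto (fun a => c a • (A a (r • x) - B (r • x))) l (𝓝 (D (r • x)))
    have h : (fun a => c a • (A a (r • x) - B (r • x))) = fun a => r • (c a • (A a x - B x)) := by
      funext a
      rw [map_smul, map_smul, ← smul_sub, smul_comm]
    rw [h, map_smul]
    exact hx.const_smul r

/-- (Ported verbatim from the HodgeCMPerL package; no docstring in the source.) -/
theorem mem_slopeSubmodule_iff (A : α → E →ₗ[ℂ] X) (B D : E →ₗ[ℂ] X) (e : E) :
    e ∈ slopeSubmodule l c A B D ↔ Tendsto (fun a => c a • (A a e - B e)) l (𝓝 (D e)) :=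
  Iff.rfl

/-- **Slopes extend by linearity**: if `c a • (A a g − B g) → D g` for every `g` of a SPANNING set, then for every `e`. -/
theorem tendsto_slope_of_span (A : α → E →ₗ[ℂ] X) (B D : E →ₗ[ℂ] X) {s : Set E} (hs : Submodule.span ℂ s = ⊤)
    (h : ∀ g ∈ s, Tendsto (fun a => c a • (A a g - B g)) l (𝓝 (D g))) (e : E) :
    Tendsto (fun a => c a • (A a e - B e)) l (𝓝 (D e)) := by
  have hle : Submodule.span ℂ s ≤ slopeSubmodule l c A B D := Submodule.span_le.2 h
  have he : e ∈ slopeSubmodule l c A B D := hle (hs ▸ Submodule.mem_top)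
  exact he

end Span

end HodgeCM.Model.HypCensus

end
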